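import Summits.ValiantsHypothesis.ValiantsHypothesis.Theorems.KPlusLogSqLawStaticPathCertSeventeenPart5
import Summits.ValiantsHypothesis.ValiantsHypothesis.Theorems.KPlusLogSqLawStaticPathChainFloorAdjacent

/-!
# Route «KPlusLogSqLaw» — KERNEL FLOOR `30·⌊m/17⌋` (rate `30/17`) for the static path sector's tropical count

HONEST FRAMING.  Helper toward the crux `WeakLifting` (item `stmt-ValiantsHypothesis-19561`, route `KPlusLogSqLaw`, cell `pub-symmetroid`,
seat val-sym-lift-p4 g10, 2026-08-27): tropical twin of the STATIC tridiagonal sector = parametric max-weight independent set on a path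
(a block of `m` items with item lines `W t θ = w₁ t θ + w₀ t`; a «chain of N changes» = `N + 1` parameters with pairwise distinct UNIQUE optima,
the kernel currency of `…StaticPathChain*`).  The located `n = 17` instance with `30 = 2·17 − 4` changes (val-sym-lift-p4 g10,
`HOME/val-sym-lift-p4/g10/data/located_g10.txt`; kernel certificate `exists_chain_thirty_on_seventeen_ends`, parts `…CertSeventeenPart1..5`) has
FREE ENDS as it stands (first optimum avoids item `1`, last optimum avoids item `17`), so g9's separator-free gluing (`exists_chain_floor_adj`,
`…ChainFloorAdjacent`) applies directly: `30·⌊m/17⌋` changes of the unique optimum on EVERY `m`-block — asymptotic rate `30/17 ≈ 1.7647`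
changes per item, above the kernel floors `26/15 ≈ 1.733` (g9) and `28/16 = 1.75` (`…ChainFloorSixteen`, this seat); the located all-`n` family F6
(rate `11/6`, LINEAR-LAW §4.5) is still not in the kernel, and the kernel CEILING is `O(n log n)` (`exists_cert_opt`, lift-p3 g6).
Nothing here asserts anything about `WeakLifting`, `TropicalB`, `KPlusLogSqLaw`, the stub `stub_tridiagonalSectorB` in its window,
`MatrixDescartes` (stmt-ValiantsHypothesis-18050) or `VP ≠ VNP`.
-/

set_option linter.dupNamespace false
set_option autoImplicit false

namespace Summit.ValiantsHypothesis.ValiantsHypothesis.Theorems.KPlusLogSqLaw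

open Finset Classical

namespace StaticPathFold

noncomputable section

/-- **KERNEL FLOOR `30·⌊m/17⌋` ON EVERY `m`-BLOCK** (the located `n = 17` instance glued to itself without separators; rate `30/17`,
the sector's best kernel floor as of this file; located truth `2n − 4` for `5 ≤ n ≤ 17`). [folklore] -/
theorem exists_chain_floor_seventeen_adj (m : ℕ) :
    ∃ (w₁ w₀ : ℕ → ℝ) (θs : Fin (30 * (m / 17) + 1) → ℝ) (Ms : Fin (30 * (m / 17) + 1) → Finset ℕ),
      StrictMono θs ∧ (∀ j, Ms j ∈ indepSets 0 m) ∧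
      (∀ j, ∀ S ∈ indepSets 0 m, S ≠ Ms j → ∑ t ∈ S, W w₁ w₀ t (θs j) < ∑ t ∈ Ms j, W w₁ w₀ t (θs j)) ∧
      (∀ e : Fin (30 * (m / 17)), Ms e.castSucc ≠ Ms e.succ) :=
  exists_chain_floor_adj exists_chain_thirty_on_seventeen_ends m

/-- the rate of the floor: `30·⌊m/17⌋ ≥ (30 m − 480)/17`, i.e. asymptotic rate `30/17` changes per item. [folklore] -/
theorem floor_seventeen_adj_rate (m : ℕ) : 30 * m ≤ 17 * (30 * (m / 17)) + 480 := by
  have := Nat.div_add_mod m 17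
  have := Nat.mod_lt m (show 0 < 17 by norm_num)
  omega

/-- the new floor constant beats the previous ones: `30/17 > 28/16 > 26/15` (as `30·16 > 28·17` and `28·15 > 26·16`). [folklore] -/
theorem floor_seventeen_rate_gt : 28 * 17 < 30 * 16 ∧ 26 * 16 < 28 * 15 := by norm_num

end

end StaticPathFold

end Summit.ValiantsHypothesis.ValiantsHypothesis.Theorems.KPlusLogSqLaw
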